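import Summits.Langlands.Langlands.Theses.OrdinaryPrimeTransport

/-!
# Birth skeleton (BC3) for crux stmt-Langlands-17318
`Summit.Langlands.Langlands.Theses.OrdinaryPrimeTransport.IrreducibleAvatarsConjugate` — line `birth`

Route `route-Langlands-OrdinaryPrimeTransport` (item #9, crux-kinded support, rank 9: UNIQUENESS UP TO
CONJUGACY of the irreducible `ℓ`-adic avatars of a cuspidal `π`).  The crux: for every `n`, number field
`F`, level witness `hcpt`, cuspidal `π` on `GL_n(𝔸_F)`, `ℓ`, `ι : ℚ̄_ℓ ≃ ℂ` and two framed
`ρ, ρ' : Γ_F → GL_n(ℚ̄_ℓ)`, both IRREDUCIBLE and both Satake–Frobenius compatible with `(π, ι)` at all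
but finitely many finite places, `IsConjugate ρ ρ'`.  This is the printed Deligne–Serre Lemme 3.2 /
Serre, *Abelian ℓ-adic representations* I §2.3 argument, and the skeleton is exactly its three classical
ingredients, each a named theorem of the literature stated over tree declarations only (no new
definitions, no hypothesis smuggled):

* `stub_satakeParamUnique` — **uniqueness of Satake parameters** (Flath 1979 Thm 3; Borel–Jacquet 1979
  §4.6): an automorphic `π = W/W'` of `GL_n(𝔸_K)` has at most one Satake parameter (multiset) at each
  finite place.  In the tree this is the named fact `AutomorphicRepData.hasSatakeParamAt_unique`, proved
  as `hasSatakeParamAt_unique_holds` in `Automorphic/AutomorphicRepsGLSatakeFlathProofs` — a module whose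
  import cone carries `JacquetLanglandsParts` / `StrongMultiplicityOneSpherical` (unproved named facts
  the argument does not use); the item text asks for a LIGHT proof (route text (ii)).
* `stub_frobeniusDense` — **Chebotarev, density-of-Frobenius form** (Serre 1968 Ch. I §2.2 Cor. 2 (a);
  Tate GCFT §2.4): for a finite set `S` of finite places of a number field `K`, the arithmetic Frobenii
  at primes over places `v ∉ S` are dense in `Γ_K` (Krull topology).  In the tree:
  `absoluteGaloisGroup.frobenius_dense hC` (`GaloisRepresentations/FrobeniusDensity`, importing
  `TunnellLemma`) fed with `chebotarev_artinRep_holds` (`Automorphic/ChebotarevArtinRepHolds`, cone through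
  `StrongArtinGL2`); the item text asks to re-home it lightly (route text (i)).
* `stub_conjOfTraceEq` — **Brauer–Nesbitt in characteristic 0 + change of frame** (Bourbaki A VIII §20
  n°6; Serre 1968 Ch. I §1.1): two IRREDUCIBLE framed `ℓ`-adic Galois representations of the same rank
  with the same trace function are `GL_n(ℚ̄_ℓ)`-conjugate.  In the tree: irreducible ⇒ semisimple,
  `Representation.nonempty_equiv_of_character_eq_of_isSemisimple` (`RepresentationTheory/Semisimple/
  EquivOfCharacter`, clean) + automatic continuity on `ℚ̄_ℓⁿ` + `FramedRep.exists_eq_conj_of_equiv`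
  (`FramedRepEquivConj`, clean) — route text (iii).
* `IrreducibleAvatarsConjugate_of` — the composition, kernel-checked WITHOUT `sorry`, concluding the route
  decl BY NAME: Satake uniqueness makes the two compatibility clauses produce a COMMON Frobenius
  characteristic polynomial at cofinitely many places (both avatars unramified there); at every arithmetic
  Frobenius over such a place the traces agree (trace = minus the sub-leading coefficient of the
  characteristic polynomial); the coincidence set `{σ | tr ρ σ = tr ρ' σ}` is closed (continuity of
  `ρ, ρ'`, `ℚ̄_ℓ` Hausdorff) and contains the dense set of good Frobenii, hence is all of `Γ_F`; then
  Brauer–Nesbitt + framing.  (This is the proof of `FramedGaloisRep.nonempty_equiv_of_hasFrobCharpolyAt_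
  eventually` of `LAdicRepFrobenius`, with its two heavy inputs cut out as stubs.)

Disproof used: none on file for this crux (`ledger crux ls stmt-Langlands-17318`: no workfiles, no
`Disproof.lean`, no `Negative/` lemmas, 2026-08-17); `ledger negatives --problem Langlands` has no entry
bearing on uniqueness of avatars.  The item is grounded IN TREE / KNOWN with two candidate proofs attached
(grounders g70-8, g70-10, 2026-08-16; heavy cone), so no stub is an instance of a refuted statement.

Shape (for `ledger skeleton check`): stubs `theorem stub_<name> : <signature> := by sorry` stated over
tree declarations only (`AutomorphicRepData.HasSatakeParamAt`, `HeightOneSpectrum.primesAbove`, Mathlib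
`IsArithFrobAt` / `Dense` / `Field.absoluteGaloisGroup`, `FramedGaloisRep`, `FramedRep.trace`,
`ContinuousRep.IsIrreducible`, `Summit.Langlands.IsConjugate`); `_Goal.stub_<name> : Prop :=
type_of% @stub_<name>` names each statement; the composition `IrreducibleAvatarsConjugate_of
(h₁ : _Goal.stub_satakeParamUnique) (h₂ : _Goal.stub_frobeniusDense) (h₃ : _Goal.stub_conjOfTraceEq) :
IrreducibleAvatarsConjugate` is proved without `sorry`.

## References

* D. Flath, *Decomposition of representations into tensor products*, Corvallis (1979), Thm. 3.
  [FlathCorvallis1979]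
* J.-P. Serre, *Abelian ℓ-adic representations and elliptic curves* (1968), Ch. I §1.1, §2.2–2.3.
  [SerreAbelianLadic1968]
* P. Deligne, J.-P. Serre, *Formes modulaires de poids 1*, ASENS 7 (1974), Lemme 3.2.
  [DeligneSerreASENS1974]
* J. Tate, *Global class field theory*, in Cassels–Fröhlich (1967), Ch. VII §2.4. [TateGCFT1967]
* N. Bourbaki, *Algèbre* VIII (2012), §20 n°6. [BourbakiAlgebreVIII2012]
-/

set_option linter.dupNamespace false
set_option linter.unusedVariables false

noncomputable section

namespace Summit.Langlands.Langlands.Cruxes.IrreducibleAvatarsConjugate.Birth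

open Summit.Langlands Summit.Langlands.Langlands.Theses.OrdinaryPrimeTransport
open Literature.NumberTheory.Automorphic Literature.NumberTheory.GaloisRepresentations
open NumberField IsDedekindDomain Field Filter
open scoped NumberField MatrixGroups Matrix Classical

/-! ## 1. The three stubs (registered; each a classical theorem, `sorry` only here) -/

/-- **STUB 1 — uniqueness of Satake parameters** (Flath 1979, Thm. 3; Borel–Jacquet 1979, §4.6): an
automorphic representation `π = W / W'` of `GL_n(𝔸_K)` has at most one Satake parameter at each finite
place `v` — the multiset `α` of `AutomorphicRepData.HasSatakeParamAt` does not depend on the auxiliary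
level, uniformiser or eigenform.  Verbatim `∀ π, π.hasSatakeParamAt_unique` (a named fact of
`AutomorphicRepsGL`, proved in the tree only inside the heavy module `AutomorphicRepsGLSatakeFlathProofs`);
to be landed through light modules. [cite: FlathCorvallis1979, Thm. 3] -/
theorem stub_satakeParamUnique :
    ∀ (n : ℕ) (K : Type) [Field K] [NumberField K] (hcpt : isCompact_glFiniteIntegralLevel n K)
      (π : AutomorphicRepData (AutomorphyDatum.gl n K hcpt)) (v : HeightOneSpectrum (𝓞 K))
      (α β : Multiset ℂ), π.HasSatakeParamAt v α → π.HasSatakeParamAt v β → α = β := by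
  sorry

/-- **STUB 2 — Chebotarev's density theorem, density-of-Frobenius form** (Serre 1968, Ch. I §2.2,
Cor. 2 (a); from Tate, GCFT §2.4): for a number field `K` and a FINITE set `S` of finite places, the set of
`σ ∈ Γ_K` that are an arithmetic Frobenius (`IsArithFrobAt (𝓞 K) σ 𝔓`, Mathlib) at some prime `𝔓` of
`\bar ℤ_K` above some place `v ∉ S` is dense in `Γ_K` for the Krull topology.  In the tree this is
`absoluteGaloisGroup.frobenius_dense` fed with `chebotarev_artinRep_holds`, both behind heavy import cones
(`TunnellLemma`, `StrongArtinGL2`); to be re-homed in a light module. [cite: SerreAbelianLadic1968, Ch. I §2.2 Cor. 2] -/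
theorem stub_frobeniusDense :
    ∀ (K : Type) [Field K] [NumberField K] (S : Set (HeightOneSpectrum (𝓞 K))), S.Finite →
      Dense {σ : absoluteGaloisGroup K |
        ∃ v ∉ S, ∃ 𝔓 ∈ v.primesAbove, IsArithFrobAt (𝓞 K) σ 𝔓} := by
  sorry

/-- **STUB 3 — Brauer–Nesbitt in characteristic `0`, framed form** (Bourbaki A VIII §20 n°6, Cor. a) of
Prop. 6; Serre 1968, Ch. I §1.1): two IRREDUCIBLE framed `ℓ`-adic Galois representations
`ρ, ρ' : Γ_K → GL_n(ℚ̄_ℓ)` with the same trace function (`FramedRep.trace`) are `GL_n(ℚ̄_ℓ)`-conjugate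
(`Summit.Langlands.IsConjugate`): irreducible ⇒ semisimple, equal characters ⇒ equivalent
(`Representation.nonempty_equiv_of_character_eq_of_isSemisimple`, automatic continuity on `ℚ̄_ℓⁿ`) ⇒
conjugate (`FramedRep.exists_eq_conj_of_equiv`). [cite: BourbakiAlgebreVIII2012, §20 n°6] -/
theorem stub_conjOfTraceEq :
    ∀ (K : Type) [Field K] (ℓ : ℕ) [Fact ℓ.Prime] (n : ℕ)
      (ρ ρ' : FramedGaloisRep K (PadicAlgCl ℓ) n),
      ρ.toGaloisRep.IsIrreducible → ρ'.toGaloisRep.IsIrreducible →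
        (∀ σ : absoluteGaloisGroup K, FramedRep.trace ρ σ = FramedRep.trace ρ' σ) →
          IsConjugate ρ ρ' := by
  sorry

/-! ## 2. The stub statements as named `Prop`s (literally their types) -/

namespace _Goal

/-- The statement of `stub_satakeParamUnique`, as a named `Prop` (literally its type). [folklore] -/
def stub_satakeParamUnique : Prop :=
  type_of% @Summit.Langlands.Langlands.Cruxes.IrreducibleAvatarsConjugate.Birth.stub_satakeParamUnique

/-- The statement of `stub_frobeniusDense`, as a named `Prop` (literally its type). [folklore] -/
def stub_frobeniusDense : Prop :=
  type_of% @Summit.Langlands.Langlands.Cruxes.IrreducibleAvatarsConjugate.Birth.stub_frobeniusDense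

/-- The statement of `stub_conjOfTraceEq`, as a named `Prop` (literally its type). [folklore] -/
def stub_conjOfTraceEq : Prop :=
  type_of% @Summit.Langlands.Langlands.Cruxes.IrreducibleAvatarsConjugate.Birth.stub_conjOfTraceEq

end _Goal

/-- The three named statements over tree vocabulary (definitional). [folklore] -/
theorem goals_iff :
    (_Goal.stub_satakeParamUnique ↔
      ∀ (n : ℕ) (K : Type) [Field K] [NumberField K] (hcpt : isCompact_glFiniteIntegralLevel n K)
        (π : AutomorphicRepData (AutomorphyDatum.gl n K hcpt)) (v : HeightOneSpectrum (𝓞 K))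
        (α β : Multiset ℂ), π.HasSatakeParamAt v α → π.HasSatakeParamAt v β → α = β) ∧
    (_Goal.stub_frobeniusDense ↔
      ∀ (K : Type) [Field K] [NumberField K] (S : Set (HeightOneSpectrum (𝓞 K))), S.Finite →
        Dense {σ : absoluteGaloisGroup K |
          ∃ v ∉ S, ∃ 𝔓 ∈ v.primesAbove, IsArithFrobAt (𝓞 K) σ 𝔓}) ∧
    (_Goal.stub_conjOfTraceEq ↔
      ∀ (K : Type) [Field K] (ℓ : ℕ) [Fact ℓ.Prime] (n : ℕ)
        (ρ ρ' : FramedGaloisRep K (PadicAlgCl ℓ) n),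
        ρ.toGaloisRep.IsIrreducible → ρ'.toGaloisRep.IsIrreducible →
          (∀ σ : absoluteGaloisGroup K, FramedRep.trace ρ σ = FramedRep.trace ρ' σ) →
            IsConjugate ρ ρ') :=
  ⟨Iff.rfl, Iff.rfl, Iff.rfl⟩

/-! ## 3. The composition (kernel-checked, no `sorry`): SATAKE → CHEBOTAREV + continuity → BRAUER–NESBITT -/

/-- **Traces from characteristic polynomials.**  Two framed representations with the same characteristic
polynomial at `σ` have the same trace at `σ` (trace `= -`coefficient of `X^{n-1}`; trivial in rank `0`).
[folklore] -/
theorem trace_eq_of_charpoly_eq {K : Type} [Field K] {ℓ : ℕ} [Fact ℓ.Prime] {n : ℕ}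
    (ρ ρ' : FramedGaloisRep K (PadicAlgCl ℓ) n) (σ : absoluteGaloisGroup K)
    (h : FramedRep.charpoly ρ σ = FramedRep.charpoly ρ' σ) :
    FramedRep.trace ρ σ = FramedRep.trace ρ' σ := by
  rcases Nat.eq_zero_or_pos n with hn | hn
  · subst hn
    simp [FramedRep.trace, Matrix.trace]
  · haveI : Nonempty (Fin n) := ⟨⟨0, hn⟩⟩
    unfold FramedRep.trace
    rw [Matrix.trace_eq_neg_charpoly_coeff, Matrix.trace_eq_neg_charpoly_coeff]
    change -((FramedRep.charpoly ρ σ).coeff _) = -((FramedRep.charpoly ρ' σ).coeff _)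
    rw [h]

/-- **`IrreducibleAvatarsConjugate` from the three stubs** (Deligne–Serre 1974, Lemme 3.2).  Given
`n, F, hcpt, π, ℓ, ι` and irreducible avatars `ρ, ρ'` both Satake–Frobenius compatible with `(π, ι)` at
cofinitely many places: by `stub_satakeParamUnique` the two Satake parameters at a doubly-good place
coincide, so `ρ, ρ'` are unramified there with a COMMON Frobenius characteristic polynomial
(`arithFrobPolyOfSatake ι q_v 1 α`); hence equal traces at every arithmetic Frobenius over such a place
(`trace_eq_of_charpoly_eq`); the set where the traces agree is closed (`FramedRep.continuous_trace`,
`ℚ̄_ℓ` Hausdorff) and contains the set of good Frobenii, dense by `stub_frobeniusDense` (the bad set is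
finite: `Filter.eventually_cofinite`), so the traces agree on all of `Γ_F`; `stub_conjOfTraceEq`
concludes.  The hypotheses are, by name, the statements of the three stubs; the conclusion is the route
decl `Summit.Langlands.Langlands.Theses.OrdinaryPrimeTransport.IrreducibleAvatarsConjugate`.
[cite: DeligneSerreASENS1974, Lemme 3.2] -/
theorem IrreducibleAvatarsConjugate_of (h₁ : _Goal.stub_satakeParamUnique)
    (h₂ : _Goal.stub_frobeniusDense) (h₃ : _Goal.stub_conjOfTraceEq) :
    Summit.Langlands.Langlands.Theses.OrdinaryPrimeTransport.IrreducibleAvatarsConjugate := by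
  classical
  -- the stub statements, as the Π-types they literally are
  have hSat : type_of% @stub_satakeParamUnique := h₁
  have hDense : type_of% @stub_frobeniusDense := h₂
  have hBN : type_of% @stub_conjOfTraceEq := h₃
  intro n F _ _ hcpt π ℓ _ ι ρ ρ' hρ hρ' h h'
  -- SATAKE: a common Frobenius characteristic polynomial at cofinitely many places
  have hev : ∀ᶠ v : HeightOneSpectrum (𝓞 F) in cofinite,
      ρ.IsUnramifiedAt v ∧ ρ'.IsUnramifiedAt v ∧
        ∃ P : Polynomial (PadicAlgCl ℓ), ρ.HasFrobCharpolyAt v P ∧ ρ'.HasFrobCharpolyAt v P := by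
    filter_upwards [h, h'] with v hv hv'
    obtain ⟨α, hα, hur, hcp⟩ := hv
    obtain ⟨α', hα', hur', hcp'⟩ := hv'
    obtain rfl : α = α' := hSat n F hcpt π.1 v α α' hα hα'
    exact ⟨hur, hur', _, hcp, hcp'⟩
  -- the finite bad set and the good Frobenii
  set S : Set (HeightOneSpectrum (𝓞 F)) := {v | ¬ (ρ.IsUnramifiedAt v ∧ ρ'.IsUnramifiedAt v ∧
      ∃ P : Polynomial (PadicAlgCl ℓ), ρ.HasFrobCharpolyAt v P ∧ ρ'.HasFrobCharpolyAt v P)}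
    with hSdef
  have hS : S.Finite := Filter.eventually_cofinite.1 hev
  set D : Set (absoluteGaloisGroup F) :=
    {σ | ∃ v ∉ S, ∃ 𝔓 ∈ v.primesAbove, IsArithFrobAt (𝓞 F) σ 𝔓} with hDdef
  -- traces agree on the good Frobenii
  have hF : D ⊆ {σ | FramedRep.trace ρ σ = FramedRep.trace ρ' σ} := by
    rintro σ ⟨v, hv, 𝔓, h𝔓, hσ⟩
    simp only [hSdef, Set.mem_setOf_eq, not_not] at hv
    obtain ⟨-, -, P, hP, hP'⟩ := hv
    have e1 : FramedRep.charpoly ρ σ = P := hP 𝔓 h𝔓 σ hσ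
    have e2 : FramedRep.charpoly ρ' σ = P := hP' 𝔓 h𝔓 σ hσ
    exact trace_eq_of_charpoly_eq ρ ρ' σ (e1.trans e2.symm)
  -- CHEBOTAREV + continuity: the coincidence set is closed and contains a dense set
  have hclosed :
      IsClosed {σ : absoluteGaloisGroup F | FramedRep.trace ρ σ = FramedRep.trace ρ' σ} :=
    isClosed_eq (FramedRep.continuous_trace ρ) (FramedRep.continuous_trace ρ')
  have hall : ∀ σ : absoluteGaloisGroup F, FramedRep.trace ρ σ = FramedRep.trace ρ' σ := by
    intro σ
    have hmem : σ ∈ closure D := by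
      rw [(hDense F S hS).closure_eq]
      exact Set.mem_univ σ
    exact hclosed.closure_subset_iff.2 hF hmem
  -- BRAUER–NESBITT + framing
  exact hBN F ℓ n ρ ρ' hρ hρ' hall

/-- By-name sanity check (an `example`, not a declaration of the file): the three stubs feed the
composition as they stand. -/
example : Summit.Langlands.Langlands.Theses.OrdinaryPrimeTransport.IrreducibleAvatarsConjugate :=
  IrreducibleAvatarsConjugate_of stub_satakeParamUnique stub_frobeniusDense stub_conjOfTraceEq

end Summit.Langlands.Langlands.Cruxes.IrreducibleAvatarsConjugate.Birth

end
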